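import Mathlib.Analysis.Complex.AbsMax
import Mathlib.Topology.MetricSpace.Thickening
import HarnessLib

/-!
# Stub `stub_maxModulus` of line `registered` (birth skeleton v2): maximum modulus on metric
# thickenings (crux `UniformAnalyticExtension`, stmt-CriticalPhenomena-6047)

Engine stub, pure complex analysis: for a bounded `S ⊆ ℂ`, `ρ > 0` and `g` complex differentiable
on the open `ρ`-thickening `Metric.thickening ρ S`, a bound `‖g‖ ≤ M` known only on the outer
"annulus" `{z ∈ thickening ρ S | ρ/2 < infDist z S}` propagates to the whole thickening.

Proof: Mathlib's maximum modulus principle `Complex.norm_le_of_forall_mem_frontier_norm_le` on the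
bounded open set `V = thickening (3ρ/4) S`, whose closure lies in `cthickening (3ρ/4) S ⊆
thickening ρ S` and whose frontier lies in the level set `infDist · S = 3ρ/4 ∈ (ρ/2, ρ)`, where the
hypothesis applies; points with `infDist ≤ ρ/2` lie in `V`.  Folklore; Mathlib only.
-/

namespace Summit.CriticalPhenomena.CardyFormulaZ2.Cruxes.UniformAnalyticExtension.Birth

open Filter Topology Set Metric

/-- **stub_maxModulus** (engine; maximum modulus principle on metric thickenings): for a bounded
`S ⊆ ℂ`, `ρ > 0` and `g` complex differentiable on `thickening ρ S`, a bound `‖g z‖ ≤ M` on the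
part of the thickening at distance `> ρ/2` from `S` propagates to the whole thickening (apply the
maximum modulus principle on `thickening (3ρ/4) S`, whose frontier lies in the level set
`infDist · S = 3ρ/4`). [folklore] -/
theorem stub_maxModulus :
    ∀ (S : Set ℂ) (ρ M : ℝ) (g : ℂ → ℂ), Bornology.IsBounded S → 0 < ρ →
      DifferentiableOn ℂ g (thickening ρ S) →
      (∀ z ∈ thickening ρ S, ρ / 2 < infDist z S → ‖g z‖ ≤ M) →
      ∀ z ∈ thickening ρ S, ‖g z‖ ≤ M := by
  intro S ρ M g hS hρ hg hM z hz
  rcases S.eq_empty_or_nonempty with rfl | hne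
  · simp at hz
  by_cases hfar : ρ / 2 < infDist z S
  · exact hM z hz hfar
  -- work on the intermediate thickening `thickening (3ρ/4) S`
  have h34pos : 0 < 3 * ρ / 4 := by positivity
  have h34lt : 3 * ρ / 4 < ρ := by linarith
  have hcl : closure (thickening (3 * ρ / 4) S) ⊆ thickening ρ S :=
    (closure_thickening_subset_cthickening _ _).trans (cthickening_subset_thickening' hρ h34lt S)
  have hzV : z ∈ thickening (3 * ρ / 4) S :=
    (mem_thickening_iff_infDist_lt hne).2 (by linarith [not_lt.mp hfar])
  have hd : DiffContOnCl ℂ g (thickening (3 * ρ / 4) S) := (hg.mono hcl).diffContOnCl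
  have hfr : ∀ x ∈ frontier (thickening (3 * ρ / 4) S), ‖g x‖ ≤ M := by
    intro x hx
    have hxE : infEDist x S = ENNReal.ofReal (3 * ρ / 4) := frontier_thickening_subset S hx
    have hxD : infDist x S = 3 * ρ / 4 := by
      rw [infDist, hxE, ENNReal.toReal_ofReal h34pos.le]
    refine hM x ((mem_thickening_iff_infDist_lt hne).2 ?_) ?_
    · rw [hxD]; exact h34lt
    · rw [hxD]; linarith
  exact Complex.norm_le_of_forall_mem_frontier_norm_le hS.thickening hd hfr (subset_closure hzV)

end Summit.CriticalPhenomena.CardyFormulaZ2.Cruxes.UniformAnalyticExtension.Birth
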